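import Literature.NumberTheory.GaloisCohomology.Howard2004.CasselsTateSkewPairingOfTowerPairingProofs
import HarnessLib

/-!
# Howard 2004: the «tower entry» of the typed print leaf C45.1′ `prop141_casselsTate_skewPairing_atLevel` in the
# ENGINE's `R`-linear currency — proofs file

Topic `NumberTheory/GaloisCohomology/Howard2004`. THEOREMS ONLY: no definition, no named fact, no instance, no notation,
no `sorry`.  Cell `pub/bsd-print-x9` (seat x10b-p1-w7 g12, brick «C451-TOWER-ENTRY-LIN», `--supports stmt-BirchSwinnertonDyer-22642`).
Companion of `CasselsTateSkewPairingOfTowerPairingProofs` (p720939): there the two-module pairing of Howard's Prop. 1.4.1 at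
`(s, t) = (t+1, 1)` on the LEVELS `N_t = T/𝔪^{t+1}T`, `N_0 = T̄` of a full tower is taken as a bi-additive map with
`R`-equivariance and kernel clauses in «equation style» (the style of the leaf); here it is taken as an `R`-BILINEAR map
`P₂ : H¹_{𝓕(n)}(K, T^{(t)}) →ₗ[R] H¹_{𝓕(n)}(K, T^{(0)}) →ₗ[R] R/𝔪` on the engine's modules `DVRSetting.selmerModuleAt` (scalars
`galoisCohomology.moduleH1`), with LEFT/RIGHT kernels the ranges of the engine's reduction letters `DVRSetting.redSelLE`
(`H¹(red_{t+1→t})`, `H¹(red_{t+1→0})`) and the skew identity of display (ii) through `redSelLE (0 ≤ t)` — the shape a kernel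
port produces with `LinearMap.mk₂` — and the five clauses of the leaf at `(k, n, t)` are returned VERBATIM
(`DVRSetting.skewPairings_display_of_towerSkewPairing_linear`).

SOURCE. B. Howard, *The Heegner point Kolyvagin system*, Compositio Math. **140** (2004) = arXiv:1202.6340, Prop. 1.4.1 and the
proof of Thm. 1.4.2 (p0008 L83–L142), §1.6 ¶1 (p0011 L33–44); M. Flach, J. reine angew. Math. **412** (1990) 113–127.

HONEST FRAMING: the two-module pairing is a HYPOTHESIS; Flach's pairing is not constructed; Prop. 1.4.1, Thm. 1.4.2, C45.1′ and
`thm161_dvrKolyvaginBound` are NOT proved; no summit statement is proved; the Birch–Swinnerton-Dyer conjecture is not proved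
by any of this.
-/

set_option autoImplicit false

noncomputable section

namespace Literature.NumberTheory.GaloisCohomology.Howard2004

open Function NumberField IsDedekindDomain Field
open scoped NumberField ContRepresentation Pointwise
open Literature.NumberTheory.GaloisRepresentations
open Literature.NumberTheory.GaloisRepresentations.DiscreteGaloisModule

/-! ## The tower entry in the ENGINE's `R`-linear currency (`selmerModuleAt`, `redSelLE`) -/

namespace DVRSetting

variable {p : ℕ} [Fact p.Prime] {K : Type} [Field K] [NumberField K]
  {R : Type} [CommRing R] [IsDomain R] [IsDiscreteValuationRing R] [Algebra ℤ_[p] R]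
  {N : ℕ → Type} [∀ k, AddCommGroup (N k)] [∀ k, TopologicalSpace (N k)]
  [∀ k, DiscreteTopology (N k)] [∀ k, Module R (N k)]
  {Rk : ℕ → Type} [∀ k, CommRing (Rk k)] [∀ k, IsLocalRing (Rk k)] [∀ k, TopologicalSpace (Rk k)]
  [∀ k, DiscreteTopology (Rk k)] [∀ k, Algebra ℤ_[p] (Rk k)] [∀ k, Algebra R (Rk k)]
  [∀ k, Module (Rk k) (N k)] [∀ k, IsScalarTower R (Rk k) (N k)]
  {Nbar : Type} [AddCommGroup Nbar] [TopologicalSpace Nbar] [DiscreteTopology Nbar]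
  [∀ k, Module (Rk k) Nbar]
  {Nq : ℕ → Finset (HeightOneSpectrum (𝓞 K)) → Type} [∀ k n, AddCommGroup (Nq k n)]
  [∀ k n, TopologicalSpace (Nq k n)] [∀ k n, DiscreteTopology (Nq k n)]
  [∀ k n, Module (Rk k) (Nq k n)] [∀ k n, Module R (Nq k n)]
  [∀ k n, IsScalarTower R (Rk k) (Nq k n)]

/-- **TOWER ENTRY, `R`-LINEAR CURRENCY.**  The same as `skewPairings_display_of_towerSkewPairing` with the two-module
pairing given as an `R`-bilinear map `P₂ : H¹_{𝓕(n)}(K, T^{(t)}) →ₗ[R] H¹_{𝓕(n)}(K, T^{(0)}) →ₗ[R] R/𝔪` on the engine's modules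
`selmerModuleAt` (scalars `galoisCohomology.moduleH1`), kernels as the ranges of the engine's reduction letters `redSelLE`
(`H¹(red_{t+1→t})`, `H¹(red_{t+1→0})`) and the skew identity through `redSelLE (0 ≤ t)` — the shape a port produces with
`LinearMap.mk₂`.  Conclusion: the five clauses of the typed leaf at `(k, n, t)`, verbatim.
[cite: Howard2004HeegnerKolyvagin, Prop. 1.4.1 and Thm. 1.4.2 (proof: identifications and displays (i)(ii)) (arXiv:1202.6340 p0008 L83–L142), §1.6 ¶1 (p0011 L33–44)]
[cite: Flach1990, the generalised Cassels–Tate pairing and its kernels] -/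
theorem skewPairings_display_of_towerSkewPairing_linear (S : DVRSetting p K R N Rk Nbar Nq) (hy : S.SatisfiesH)
    (hfull : ∀ i, S.e i = i + 1) (k : ℕ) (n : Finset (HeightOneSpectrum (𝓞 K)))
    (hn : ↑n ⊆ S.levelPrimes k) (t : ℕ) (ht : t + 1 < S.e k)
    (P₂ : letI := galoisCohomology.moduleH1 (S.T.ρ t) (S.T.hlin t)
      letI := galoisCohomology.moduleH1 (S.T.ρ 0) (S.T.hlin 0)
      ↥(S.selmerModuleAt hy t n) →ₗ[R] ↥(S.selmerModuleAt hy 0 n) →ₗ[R] (R ⧸ IsLocalRing.maximalIdeal R))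
    (hleft : letI := galoisCohomology.moduleH1 (S.T.ρ t) (S.T.hlin t)
      letI := galoisCohomology.moduleH1 (S.T.ρ 0) (S.T.hlin 0)
      letI := galoisCohomology.moduleH1 (S.T.ρ (t + 1)) (S.T.hlin (t + 1))
      ∀ a : ↥(S.selmerModuleAt hy t n), (∀ w, P₂ a w = 0) ↔
        a ∈ LinearMap.range (S.redSelLE hy (Nat.le_succ t) n))
    (hright : letI := galoisCohomology.moduleH1 (S.T.ρ t) (S.T.hlin t)
      letI := galoisCohomology.moduleH1 (S.T.ρ 0) (S.T.hlin 0)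
      letI := galoisCohomology.moduleH1 (S.T.ρ (t + 1)) (S.T.hlin (t + 1))
      ∀ w : ↥(S.selmerModuleAt hy 0 n), (∀ a, P₂ a w = 0) ↔
        w ∈ LinearMap.range (S.redSelLE hy (Nat.zero_le (t + 1)) n))
    (hskew : letI := galoisCohomology.moduleH1 (S.T.ρ t) (S.T.hlin t)
      letI := galoisCohomology.moduleH1 (S.T.ρ 0) (S.T.hlin 0)
      ∀ a b : ↥(S.selmerModuleAt hy t n),
        P₂ a (S.redSelLE hy (Nat.zero_le t) n b) = - P₂ b (S.redSelLE hy (Nat.zero_le t) n a)) :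
    ∃ P : ↥((((S.t k).atLevel S.jbar n).cond).selmerGroup ⊓
        (galoisCohomology.scalarMapH1 (S.T.ρ k) (S.T.hlin k) (S.π ^ (t + 1))).ker) →+
      ↥((((S.t k).atLevel S.jbar n).cond).selmerGroup ⊓
        (galoisCohomology.scalarMapH1 (S.T.ρ k) (S.T.hlin k) S.π).ker) →+ (R ⧸ IsLocalRing.maximalIdeal R),
      (∀ (r : R) (x x' : ↥((((S.t k).atLevel S.jbar n).cond).selmerGroup ⊓
          (galoisCohomology.scalarMapH1 (S.T.ρ k) (S.T.hlin k) (S.π ^ (t + 1))).ker))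
          (w : ↥((((S.t k).atLevel S.jbar n).cond).selmerGroup ⊓
            (galoisCohomology.scalarMapH1 (S.T.ρ k) (S.T.hlin k) S.π).ker)),
        (x' : galoisCohomology (S.T.ρ k) 1) =
          galoisCohomology.scalarMapH1 (S.T.ρ k) (S.T.hlin k) r (x : galoisCohomology (S.T.ρ k) 1) →
        P x' w = r • P x w) ∧
      (∀ (r : R) (x : ↥((((S.t k).atLevel S.jbar n).cond).selmerGroup ⊓
          (galoisCohomology.scalarMapH1 (S.T.ρ k) (S.T.hlin k) (S.π ^ (t + 1))).ker))
          (w w' : ↥((((S.t k).atLevel S.jbar n).cond).selmerGroup ⊓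
            (galoisCohomology.scalarMapH1 (S.T.ρ k) (S.T.hlin k) S.π).ker)),
        (w' : galoisCohomology (S.T.ρ k) 1) =
          galoisCohomology.scalarMapH1 (S.T.ρ k) (S.T.hlin k) r (w : galoisCohomology (S.T.ρ k) 1) →
        P x w' = r • P x w) ∧
      (∀ x : ↥((((S.t k).atLevel S.jbar n).cond).selmerGroup ⊓
          (galoisCohomology.scalarMapH1 (S.T.ρ k) (S.T.hlin k) (S.π ^ (t + 1))).ker),
        (∀ w, P x w = 0) ↔
          ∃ z ∈ (((S.t k).atLevel S.jbar n).cond).selmerGroup,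
            galoisCohomology.scalarMapH1 (S.T.ρ k) (S.T.hlin k) (S.π ^ (t + 2)) z = 0 ∧
            (x : galoisCohomology (S.T.ρ k) 1) = galoisCohomology.scalarMapH1 (S.T.ρ k) (S.T.hlin k) S.π z) ∧
      (∀ w : ↥((((S.t k).atLevel S.jbar n).cond).selmerGroup ⊓
          (galoisCohomology.scalarMapH1 (S.T.ρ k) (S.T.hlin k) S.π).ker),
        (∀ x, P x w = 0) ↔
          ∃ z ∈ (((S.t k).atLevel S.jbar n).cond).selmerGroup,
            galoisCohomology.scalarMapH1 (S.T.ρ k) (S.T.hlin k) (S.π ^ (t + 2)) z = 0 ∧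
            (w : galoisCohomology (S.T.ρ k) 1) =
              galoisCohomology.scalarMapH1 (S.T.ρ k) (S.T.hlin k) (S.π ^ (t + 1)) z) ∧
      (∀ (a b : ↥((((S.t k).atLevel S.jbar n).cond).selmerGroup ⊓
          (galoisCohomology.scalarMapH1 (S.T.ρ k) (S.T.hlin k) (S.π ^ (t + 1))).ker))
          (a' b' : ↥((((S.t k).atLevel S.jbar n).cond).selmerGroup ⊓
            (galoisCohomology.scalarMapH1 (S.T.ρ k) (S.T.hlin k) S.π).ker)),
        (a' : galoisCohomology (S.T.ρ k) 1) =
          galoisCohomology.scalarMapH1 (S.T.ρ k) (S.T.hlin k) (S.π ^ t) (a : galoisCohomology (S.T.ρ k) 1) →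
        (b' : galoisCohomology (S.T.ρ k) 1) =
          galoisCohomology.scalarMapH1 (S.T.ρ k) (S.T.hlin k) (S.π ^ t) (b : galoisCohomology (S.T.ρ k) 1) →
        P a b' = - P b a') := by
  letI instT := galoisCohomology.moduleH1 (S.T.ρ t) (S.T.hlin t)
  letI inst0 := galoisCohomology.moduleH1 (S.T.ρ 0) (S.T.hlin 0)
  letI instS := galoisCohomology.moduleH1 (S.T.ρ (t + 1)) (S.T.hlin (t + 1))
  -- repackaging `𝓗_j(n)` (additive subgroup) as the engine's module `selmerModuleAt` (same carrier)
  let toT : ↥(((S.t t).atLevel S.jbar n).cond).selmerGroup →+ ↥(S.selmerModuleAt hy t n) :=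
    AddMonoidHom.mk' (fun a => ⟨a.1, (S.mem_selmerModuleAt_iff hy t n a.1).2 a.2⟩) (fun _ _ => rfl)
  let to0 : ↥(((S.t 0).atLevel S.jbar n).cond).selmerGroup →+ ↥(S.selmerModuleAt hy 0 n) :=
    AddMonoidHom.mk' (fun a => ⟨a.1, (S.mem_selmerModuleAt_iff hy 0 n a.1).2 a.2⟩) (fun _ _ => rfl)
  have htoT : ∀ a, ((toT a : ↥(S.selmerModuleAt hy t n)) : galoisCohomology (S.T.ρ t) 1) = a.1 := fun _ => rfl
  have hto0 : ∀ a, ((to0 a : ↥(S.selmerModuleAt hy 0 n)) : galoisCohomology (S.T.ρ 0) 1) = a.1 := fun _ => rfl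
  -- the additive two-module pairing `Q(a, w) = P₂(a, w)`
  let Q : ↥(((S.t t).atLevel S.jbar n).cond).selmerGroup →+
      ↥(((S.t 0).atLevel S.jbar n).cond).selmerGroup →+ (R ⧸ IsLocalRing.maximalIdeal R) :=
    ((LinearMap.toAddMonoidHom'.comp P₂.toAddMonoidHom).comp toT).compl₂ to0
  have hQ : ∀ a w, Q a w = P₂ (toT a) (to0 w) := fun a w => by
    show (((LinearMap.toAddMonoidHom'.comp P₂.toAddMonoidHom).comp toT).compl₂ to0) a w = _
    rw [AddMonoidHom.compl₂_apply, AddMonoidHom.comp_apply, AddMonoidHom.comp_apply]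
    rfl
  refine S.skewPairings_display_of_towerSkewPairing hy hfull k n hn t ht Q ?_ ?_ ?_ ?_ ?_
  · -- `R`-equivariance in the first slot
    intro r a a' w ha'
    have h1 : toT a' = r • toT a := Subtype.ext ha'
    rw [hQ, hQ, h1, map_smul, LinearMap.smul_apply]
  · -- `R`-equivariance in the second slot
    intro r a w w' hw'
    have h1 : to0 w' = r • to0 w := Subtype.ext hw'
    rw [hQ, hQ, h1, map_smul]
  · -- LEFT kernel
    intro a
    have step1 : (∀ w, Q a w = 0) ↔ ∀ w' : ↥(S.selmerModuleAt hy 0 n), P₂ (toT a) w' = 0 := by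
      constructor
      · intro h w'
        have h2 := h ⟨w'.1, (S.mem_selmerModuleAt_iff hy 0 n w'.1).1 w'.2⟩
        rw [hQ] at h2
        exact h2
      · intro h w
        rw [hQ]
        exact h _
    rw [step1, hleft (toT a), LinearMap.mem_range]
    constructor
    · rintro ⟨y, hy'⟩
      refine ⟨y.1, (S.mem_selmerModuleAt_iff hy (t + 1) n y.1).1 y.2, ?_⟩
      rw [← htoT a, ← hy', S.coe_redSelLE_apply]
    · rintro ⟨z, hz, hza⟩
      refine ⟨⟨z, (S.mem_selmerModuleAt_iff hy (t + 1) n z).2 hz⟩, Subtype.ext ?_⟩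
      rw [S.coe_redSelLE_apply, htoT, hza]
  · -- RIGHT kernel
    intro w
    have step1 : (∀ a, Q a w = 0) ↔ ∀ a' : ↥(S.selmerModuleAt hy t n), P₂ a' (to0 w) = 0 := by
      constructor
      · intro h a'
        have h2 := h ⟨a'.1, (S.mem_selmerModuleAt_iff hy t n a'.1).1 a'.2⟩
        rw [hQ] at h2
        exact h2
      · intro h a
        rw [hQ]
        exact h _
    rw [step1, hright (to0 w), LinearMap.mem_range]
    constructor
    · rintro ⟨y, hy'⟩
      refine ⟨y.1, (S.mem_selmerModuleAt_iff hy (t + 1) n y.1).1 y.2, ?_⟩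
      rw [← hto0 w, ← hy', S.coe_redSelLE_apply]
    · rintro ⟨z, hz, hzw⟩
      refine ⟨⟨z, (S.mem_selmerModuleAt_iff hy (t + 1) n z).2 hz⟩, Subtype.ext ?_⟩
      rw [S.coe_redSelLE_apply, hto0, hzw]
  · -- skew-symmetry
    intro a b a₀ b₀ ha₀ hb₀
    have h1 : to0 a₀ = S.redSelLE hy (Nat.zero_le t) n (toT a) := Subtype.ext (by
      rw [S.coe_redSelLE_apply, hto0, htoT, ha₀])
    have h2 : to0 b₀ = S.redSelLE hy (Nat.zero_le t) n (toT b) := Subtype.ext (by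
      rw [S.coe_redSelLE_apply, hto0, htoT, hb₀])
    rw [hQ, hQ, h1, h2]
    exact hskew (toT a) (toT b)

end DVRSetting

end Literature.NumberTheory.GaloisCohomology.Howard2004

end
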